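import Summits.ResolutionOfSingularities.ResolutionOfSingularities.Theorems.WeightedInvariantHypersurfaceCentreAssemblyPointDict
import Mathlib.RingTheory.Ideal.AssociatedPrime.Localization
import Mathlib.Algebra.Module.LocalizedModule.Submodule
import HarnessLib

/-!
# Associated points of an ideal sheaf are INTRINSIC: the associated primes of `Γ(U) ⧸ I(U)` at a point do not depend on the affine open `U`

Route `ResolutionOfSingularities/WeightedInvariant`, crux `Theses.WeightedInvariant.HypersurfaceCentreConstruction`
(stmt-ResolutionOfSingularities-19897), door line `local-engine`, E2 tier, registered stub `stub_e2_centre_h`, word (G-6b); status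
`Cruxes/HypersurfaceCentreConstruction/G6B-LEMMA-H-STATUS.md`.  The last input «(a″)» («`Rₙ(W)` has no embedded associated points», for a FOREIGN affine
open `W`) is computed on the MODEL CHARTS `D(t ℓ)` of …E2ModelCoverOfMaximal; this file supplies the transfer of associatedness between affine opens:
* `comap_mem_associatedPrimes_quotient_iff` — for a localisation `A → B` at `p` (Noetherian `A`) and an ideal `I ≤ A`: a prime `𝔔` of `B` is associated
  to `B ⧸ I·B` iff `𝔔 ∩ A` is associated to `A ⧸ I` (Mathlib's `Module.associatedPrimes.preimage_comap_associatedPrimes_eq_associatedPrimes_of_isLocalizedModule`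
  on the localized quotient `Submodule.toLocalizedQuotient'`);
* `primeIdealOf_mem_associatedPrimes_iff_basicOpen` — for an ideal sheaf `I`, an affine open `U`, `r ∈ Γ(U)` and `ξ ∈ D(r)`: `𝔭_U(ξ)` is associated to
  `Γ(U) ⧸ I(U)` iff `𝔭_{D(r)}(ξ)` is associated to `Γ(D(r)) ⧸ I(D(r))`;
* `primeIdealOf_mem_associatedPrimes_iff_of_mem` — the same for ANY two affine opens `U, V ∋ ξ` (common basic open).
Def-free helper (`--supports stmt-ResolutionOfSingularities-19897`); plain bookkeeping; AI-written, weaker than expert review. [OURS · L1 W4.3] [folklore]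
-/

noncomputable section

set_option linter.dupNamespace false -- mandated namespace of this single-conjunct summit
set_option backward.isDefEq.respectTransparency false

open CategoryTheory AlgebraicGeometry TopologicalSpace IsLocalRing Topology
open Literature.AlgebraicGeometry.Resolution
open Summit.ResolutionOfSingularities.ResolutionOfSingularities.Theorems

namespace Summit.ResolutionOfSingularities.ResolutionOfSingularities.Cruxes.HypersurfaceCentreConstruction.LocalEngine

/-! ## Ring level -/

/-- **Associated primes of `B ⧸ I·B` for a localisation `A → B`** are exactly the primes whose contraction is associated to `A ⧸ I`
(Noetherian `A`). [folklore] -/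
theorem comap_mem_associatedPrimes_quotient_iff {A : Type*} [CommRing A] [IsNoetherianRing A] (p : Submonoid A)
    (B : Type*) [CommRing B] [Algebra A B] [IsLocalization p B] (I : Ideal A) (𝔔 : Ideal B) :
    𝔔 ∈ associatedPrimes B (B ⧸ I.map (algebraMap A B)) ↔ 𝔔.comap (algebraMap A B) ∈ associatedPrimes A (A ⧸ I) := by
  let f := Submodule.toLocalizedQuotient' B p (Algebra.linearMap A B) I
  have key := Module.associatedPrimes.preimage_comap_associatedPrimes_eq_associatedPrimes_of_isLocalizedModule
    (S := p) (f := f) (R' := B)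
  have e : (B ⧸ Submodule.localized' B p (Algebra.linearMap A B) I) ≃ₗ[B] (B ⧸ I.map (algebraMap A B)) :=
    Submodule.quotEquivOfEq _ _ (Ideal.localized'_eq_map B p I)
  rw [← LinearEquiv.AssociatedPrimes.eq e, ← key]
  rfl

/-- The same with the ideal of `B` given up to an equation (for rewriting-free use). [folklore] -/
theorem comap_mem_associatedPrimes_quotient_iff' {A : Type*} [CommRing A] [IsNoetherianRing A] (p : Submonoid A)
    (B : Type*) [CommRing B] [Algebra A B] [IsLocalization p B] (I : Ideal A) (I' : Ideal B)
    (hI' : I' = I.map (algebraMap A B)) (𝔔 : Ideal B) :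
    𝔔 ∈ associatedPrimes B (B ⧸ I') ↔ 𝔔.comap (algebraMap A B) ∈ associatedPrimes A (A ⧸ I) := by
  subst hI'
  exact comap_mem_associatedPrimes_quotient_iff p B I 𝔔

/-! ## Scheme level -/

section Scheme

variable {Y : Scheme.{0}} (I : Y.IdealSheafData)

/-- The prime of a point of a basic open `D(r) ⊆ U` contracts to its prime in `U`. [folklore] -/
theorem comap_primeIdealOf_affineBasicOpen (U : Y.affineOpens) (r : Γ(Y, U)) {ξ : Y} (hξU : ξ ∈ (U : Y.Opens))
    (hξr : ξ ∈ Y.basicOpen r) :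
    (((Y.affineBasicOpen r).2.primeIdealOf ⟨ξ, hξr⟩).asIdeal).comap
        (Y.presheaf.map (homOfLE (Y.basicOpen_le r)).op).hom = (U.2.primeIdealOf ⟨ξ, hξU⟩).asIdeal := by
  ext s
  rw [Ideal.mem_comap]
  have h1 := mem_basicOpen_iff_not_mem (Y.affineBasicOpen r) hξr ((Y.presheaf.map (homOfLE (Y.basicOpen_le r)).op).hom s)
  have h2 := mem_basicOpen_iff_not_mem U hξU s
  have h3 : ξ ∈ Y.basicOpen ((Y.presheaf.map (homOfLE (Y.basicOpen_le r)).op).hom s) ↔ ξ ∈ Y.basicOpen s := by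
    rw [Scheme.basicOpen_res]
    exact ⟨fun h => h.2, fun h => ⟨hξr, h⟩⟩
  constructor
  · intro hs
    by_contra hs'
    exact (h1.mp (h3.mpr (h2.mpr hs'))) hs
  · intro hs
    by_contra hs'
    exact (h2.mp (h3.mp (h1.mpr hs'))) hs

/-- **Associatedness passes to basic opens**: for `ξ ∈ D(r) ⊆ U`, `𝔭_U(ξ)` is associated to `Γ(U) ⧸ I(U)` iff `𝔭_{D(r)}(ξ)` is associated to
`Γ(D(r)) ⧸ I(D(r))` (Noetherian sections). [folklore] -/
theorem primeIdealOf_mem_associatedPrimes_iff_basicOpen (U : Y.affineOpens) [IsNoetherianRing Γ(Y, U)] (r : Γ(Y, U)) {ξ : Y}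
    (hξU : ξ ∈ (U : Y.Opens)) (hξr : ξ ∈ Y.basicOpen r) :
    (U.2.primeIdealOf ⟨ξ, hξU⟩).asIdeal ∈ associatedPrimes Γ(Y, U) (Γ(Y, U) ⧸ I.ideal U) ↔
      ((Y.affineBasicOpen r).2.primeIdealOf ⟨ξ, hξr⟩).asIdeal ∈
        associatedPrimes Γ(Y, Y.affineBasicOpen r) (Γ(Y, Y.affineBasicOpen r) ⧸ I.ideal (Y.affineBasicOpen r)) := by
  letI alg : Algebra Γ(Y, U) Γ(Y, Y.affineBasicOpen r) := (Y.presheaf.map (homOfLE (Y.basicOpen_le r)).op).hom.toAlgebra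
  haveI inst : IsLocalization.Away r Γ(Y, Y.affineBasicOpen r) := U.2.isLocalization_basicOpen r
  have hI : I.ideal (Y.affineBasicOpen r) = (I.ideal U).map (algebraMap Γ(Y, U) Γ(Y, Y.affineBasicOpen r)) :=
    (I.map_ideal_basicOpen U r).symm
  have hc : (((Y.affineBasicOpen r).2.primeIdealOf ⟨ξ, hξr⟩).asIdeal).comap (algebraMap Γ(Y, U) Γ(Y, Y.affineBasicOpen r)) =
      (U.2.primeIdealOf ⟨ξ, hξU⟩).asIdeal :=
    comap_primeIdealOf_affineBasicOpen U r hξU hξr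
  have key := comap_mem_associatedPrimes_quotient_iff' (.powers r) Γ(Y, Y.affineBasicOpen r) (I.ideal U) _ hI
    ((Y.affineBasicOpen r).2.primeIdealOf ⟨ξ, hξr⟩).asIdeal
  rw [hc] at key
  exact key.symm

/-- Transport of the basic-open statement along an equality of affine opens. [folklore] -/
theorem primeIdealOf_mem_associatedPrimes_iff_of_eq {W₁ W₂ : Y.affineOpens} (h : W₁ = W₂) {ξ : Y}
    (h₁ : ξ ∈ (W₁ : Y.Opens)) (h₂ : ξ ∈ (W₂ : Y.Opens)) :
    (W₁.2.primeIdealOf ⟨ξ, h₁⟩).asIdeal ∈ associatedPrimes Γ(Y, W₁) (Γ(Y, W₁) ⧸ I.ideal W₁) ↔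
      (W₂.2.primeIdealOf ⟨ξ, h₂⟩).asIdeal ∈ associatedPrimes Γ(Y, W₂) (Γ(Y, W₂) ⧸ I.ideal W₂) := by
  subst h
  rfl

/-- **ASSOCIATED POINTS ARE INTRINSIC**: for two affine opens `U, V ∋ ξ` of a locally Noetherian scheme, `𝔭_U(ξ)` is associated to
`Γ(U) ⧸ I(U)` iff `𝔭_V(ξ)` is associated to `Γ(V) ⧸ I(V)` (through a common basic open). [folklore] -/
theorem primeIdealOf_mem_associatedPrimes_iff_of_mem [IsLocallyNoetherian Y] (U V : Y.affineOpens) {ξ : Y}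
    (hξU : ξ ∈ (U : Y.Opens)) (hξV : ξ ∈ (V : Y.Opens)) :
    (U.2.primeIdealOf ⟨ξ, hξU⟩).asIdeal ∈ associatedPrimes Γ(Y, U) (Γ(Y, U) ⧸ I.ideal U) ↔
      (V.2.primeIdealOf ⟨ξ, hξV⟩).asIdeal ∈ associatedPrimes Γ(Y, V) (Γ(Y, V) ⧸ I.ideal V) := by
  haveI : IsNoetherianRing Γ(Y, U) := IsLocallyNoetherian.component_noetherian U
  haveI : IsNoetherianRing Γ(Y, V) := IsLocallyNoetherian.component_noetherian V
  obtain ⟨f, g, hfg, hξf⟩ := exists_basicOpen_le_affine_inter U.2 V.2 ξ ⟨hξU, hξV⟩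
  have hξg : ξ ∈ Y.basicOpen g := hfg ▸ hξf
  have e : Y.affineBasicOpen f = Y.affineBasicOpen g := Subtype.ext hfg
  rw [primeIdealOf_mem_associatedPrimes_iff_basicOpen I U f hξU hξf, primeIdealOf_mem_associatedPrimes_iff_basicOpen I V g hξV hξg]
  exact primeIdealOf_mem_associatedPrimes_iff_of_eq I e hξf hξg

end Scheme

end Summit.ResolutionOfSingularities.ResolutionOfSingularities.Cruxes.HypersurfaceCentreConstruction.LocalEngine

end
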